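import Literature.MathematicalPhysics.QuantumLattice.HubbardGridFieldSubstitution
import Literature.MathematicalPhysics.QuantumLattice.HubbardEffectiveActionCT
import Literature.MathematicalPhysics.QuantumLattice.GrassmannKernelsPresented
import HarnessLib

/-!
# The time-grid image of the quadratic COUNTERTERM vertex `𝒩_K`: a time-local, space-nonlocal grid polynomial with the
# lattice Fourier coefficients of the frame as kernel, its exact image `counterQuadratic`, and its pinned `ℓ¹` kernel norm

Topic `MathematicalPhysics/QuantumLattice`; companion of `HubbardGridFieldSubstitution` (the `N`-point time grid
`GridPoint L N`, the substitution `hubbardGridSub L M β N`, the grid-LOCAL quartic `hubbardGridInteraction` with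
`map S V_N = hubbardInteraction` for `4M ≤ N + 1`) and of `HubbardEffectiveActionCT` (the countertermed interaction
`V_K = hubbardInteraction + counterQuadratic L M β K`, `𝒩_K = Σ_{k,σ} K(p_k⃗)(βL²)⁻¹ ψ̂⁺_{kσ}ψ̂⁻_{kσ}`, BGM 2003 (2.10)).  The
point: to run the ultraviolet (scale-`0`) Gaussian step of the countertermed Hubbard action in position–time `L¹–L^∞` norms
uniformly in the Matsubara cutoff `M` (Pedra–Salmhofer determinant bound on the `4M` grid), the WHOLE interaction `V_K`
must be pulled back to the grid algebra; this file supplies the counterterm half.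

* §1 `framePosKernel L K z⃗ = Ǩ_L(z⃗) := L⁻² Σ_{q ∈ (ℤ/L)²} K(p_q) conj χ_q(z⃗)` — the lattice Fourier coefficients of the frame;
  `sum_sum_framePosKernel_mul_torusChar` (`Σ_{x,y} Ǩ_L(x−y) χ_k(x) conj χ_{k'}(y) = L² K(p_k) [k = k']`, character orthogonality);
  `harmonic_latticeMomentum_eq_sum_torusChar` (each `C₄ᵥ` harmonic `h_{m,n}(p_q) = ⅛ Σ_{8 signed/swapped shifts a} χ_q(a)`),
  hence `Ǩ_L` is a finite combination of lattice deltas and **`sum_norm_framePosKernel_le : Σ_z ‖Ǩ_L(z)‖ ≤ coeffNorm 0 K`** for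
  EVERY `L ≥ 1` (aliasing only merges deltas).
* §2 `hubbardGridCounterQuadratic L N β K := (β/N) Σ_σ Σ_{(j,x⃗),y⃗} Ǩ_L(x⃗ − y⃗) ψ⁺_{((j,x⃗),σ)} ψ⁻_{((j,y⃗),σ)}` (time-LOCAL, the
  Riemann sum of `∫dτ Σ_{x,y} Ǩ(x−y) ψ⁺_{x,τ}ψ⁻_{y,τ}`) and **`map_hubbardGridSub_gridCounterQuadratic`**:
  `map (toLin' S_N) (hubbardGridCounterQuadratic L N β K) = counterQuadratic L M β K` for `2M ≤ N`, `β ≠ 0` — exact, because the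
  frequency transfer `n − n'` of a quadratic monomial has `|n − n'| ≤ 2M − 1 < N` (discrete time orthogonality
  `sum_exp_freqTransfer_gridTime`) and the spatial double sum is the orthogonality of §1.
* §3 kernels: `kernel_two_gen_mul_gen` (the `2`-point kernel of `ψ(a)ψ(b)` is `½([Y=(a,b)] − [Y=(b,a)])`), the generic pinned-sum bound
  `sum_norm_kernel_two_structured_le` for any structured quadratic `Σ_i c_i ψ(a_i)ψ(b_i)` (the antisymmetrisation's `½` pays for the
  two orderings), and for the grid counterterm **`sum_norm_kernel_hubbardGridCounterQuadratic_le`**: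
  `Σ_{Y : Y p = w} ‖kernel 𝒩_{K,N} 2 Y‖ ≤ (|β|/N)·coeffNorm 0 K` (every leg `w`, both slots `p`, every `L, N`), plus the vanishing of all
  other kernels (`kernel_hubbardGridCounterQuadratic_of_ne`) and of the constant part — the `N(1)` input of the determinant-bounded
  single-scale step `GrassmannEffectiveActionBoundDB.sum_norm_kernel_effAction_le_of_gramBounded`.

Everything is proved; the definitions are the position kernel and the grid polynomial; no named facts.

## Sources

G. Benfatto, A. Giuliani, V. Mastropietro, Ann. Henri Poincaré 4 (2003) 137–193, §1.2 (2.9)–(2.10) (the counterterm `𝒩`)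
[`BenfattoGiulianiMastropietro2003`]; G. Benfatto, A. Giuliani, V. Mastropietro, Ann. Henri Poincaré 7 (2006) 809–898, §2.1
(2.5)–(2.6a) [`BenfattoGiulianiMastropietro2006`]; M. Salmhofer, *Renormalization* (1999), §4.2.4 (4.54)–(4.59) (time-lattice
action, orthogonality) [`Salmhofer1999`].
-/

noncomputable section

namespace Literature.MathematicalPhysics.QuantumLattice

open GrassmannAlgebra Finset Literature.Probability.LatticeModels
open scoped ComplexConjugate

/-! ### §1 The lattice Fourier coefficients of the frame -/

section PositionKernel

variable (L : ℕ) [NeZero L]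

/-- **The position-space kernel of the frame** on the `L`-torus: `Ǩ_L(z⃗) = L⁻² Σ_{q ∈ (ℤ/Lℤ)²} K(p_q) conj χ_q(z⃗)` (the lattice
Fourier coefficients of `q ↦ K(p_q)`, so that `Σ_z Ǩ_L(z) χ_k(z) = K(p_k)`). [cite: BenfattoGiulianiMastropietro2003, §1.2 The model (2.10)] -/
def framePosKernel (K : TrigPolyC4v) (z : TorusSite 2 L) : ℂ :=
  ((L : ℂ) ^ 2)⁻¹ * ∑ q : TorusSite 2 L, (K.eval (latticeMomentum L q) : ℂ) * conj (torusChar q z)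

/-- The position kernel of a single `C₄ᵥ` harmonic: `ȟ_{m,n}(z⃗) = L⁻² Σ_q h_{m,n}(p_q) conj χ_q(z⃗)`. [folklore] -/
def harmonicPosKernel (m n : ℕ) (z : TorusSite 2 L) : ℂ :=
  ((L : ℂ) ^ 2)⁻¹ * ∑ q : TorusSite 2 L, (TrigPolyC4v.harmonic m n (latticeMomentum L q) : ℂ) * conj (torusChar q z)

/-- The eight signed / swapped lattice shifts `(±m, ±n)`, `(±n, ±m)` carried by the harmonic `h_{m,n}` (indexed by
`(sign, sign, swap) ∈ Fin 2 × Fin 2 × Fin 2`; coincidences allowed). [folklore] -/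
def harmonicShift (m n : ℕ) (e : Fin 2 × Fin 2 × Fin 2) : TorusSite 2 L :=
  if e.2.2 = 0 then ![(if e.1 = 0 then (m : ZMod L) else -(m : ZMod L)), (if e.2.1 = 0 then (n : ZMod L) else -(n : ZMod L))]
  else ![(if e.1 = 0 then (n : ZMod L) else -(n : ZMod L)), (if e.2.1 = 0 then (m : ZMod L) else -(m : ZMod L))]

variable {L}

/-- `e^{i m p_{q,i}} = χ(m·q_i)` — an integer multiple of a lattice momentum component is a character value. [folklore] -/
private theorem exp_nat_mul_latticeMomentum_mul_I (m : ℕ) (q : TorusSite 2 L) (i : Fin 2) :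
    Complex.exp (((m * latticeMomentum L q i : ℝ) : ℂ) * Complex.I) = (ZMod.stdAddChar ((m : ZMod L) * q i) : ℂ) := by
  have hcast : (m : ZMod L) * q i = (((m * (q i).val : ℕ) : ℤ) : ZMod L) := by
    push_cast
    rw [ZMod.natCast_zmod_val]
  rw [hcast, ZMod.stdAddChar_coe, latticeMomentum]
  congr 1
  push_cast
  ring

/-- `e^{-i m p_{q,i}} = χ(−m·q_i)`. [folklore] -/
private theorem exp_neg_nat_mul_latticeMomentum_mul_I (m : ℕ) (q : TorusSite 2 L) (i : Fin 2) :
    Complex.exp (-((m * latticeMomentum L q i : ℝ) : ℂ) * Complex.I) = (ZMod.stdAddChar (-(m : ZMod L) * q i) : ℂ) := by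
  have hcast : -(m : ZMod L) * q i = (((-((m * (q i).val : ℕ) : ℤ)) : ℤ) : ZMod L) := by
    push_cast
    rw [ZMod.natCast_zmod_val]
    ring
  rw [hcast, ZMod.stdAddChar_coe, latticeMomentum]
  congr 1
  push_cast
  ring

/-- `cos(m p_{q,i}) = ½(χ(m q_i) + χ(−m q_i))` in `ℂ`. [folklore] -/
private theorem cos_nat_mul_latticeMomentum_eq (m : ℕ) (q : TorusSite 2 L) (i : Fin 2) :
    ((Real.cos (m * latticeMomentum L q i) : ℝ) : ℂ) =
      ((ZMod.stdAddChar ((m : ZMod L) * q i) : ℂ) + (ZMod.stdAddChar (-(m : ZMod L) * q i) : ℂ)) / 2 := by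
  rw [Complex.ofReal_cos, Complex.cos, exp_nat_mul_latticeMomentum_mul_I, exp_neg_nat_mul_latticeMomentum_mul_I]

/-- `cos(m p_{q,i}) = ½ Σ_{s ∈ Fin 2} χ(±_s m q_i)`. [folklore] -/
private theorem cos_nat_mul_latticeMomentum_eq_sum (m : ℕ) (q : TorusSite 2 L) (i : Fin 2) :
    ((Real.cos (m * latticeMomentum L q i) : ℝ) : ℂ) =
      (2 : ℂ)⁻¹ * ∑ s : Fin 2, (ZMod.stdAddChar ((if s = 0 then (m : ZMod L) else -(m : ZMod L)) * q i) : ℂ) := by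
  rw [cos_nat_mul_latticeMomentum_eq, Fin.sum_univ_two, if_pos rfl, if_neg (show (1 : Fin 2) ≠ 0 by decide)]
  ring

/-- The character of `q` at a two-component shift: `χ_q(![a, b]) = χ(a q₀) χ(b q₁)`. [folklore] -/
private theorem torusChar_vec2 (q : TorusSite 2 L) (a b : ZMod L) :
    torusChar q ![a, b] = (ZMod.stdAddChar (a * q 0) : ℂ) * (ZMod.stdAddChar (b * q 1) : ℂ) := by
  simp [torusChar, Fin.prod_univ_two, mul_comm]

omit [NeZero L] in
/-- The unswapped shifts `(±m, ±n)`. [folklore] -/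
private theorem harmonicShift_apply_zero (m n : ℕ) (s t : Fin 2) :
    harmonicShift L m n (s, t, 0) =
      ![(if s = 0 then (m : ZMod L) else -(m : ZMod L)), (if t = 0 then (n : ZMod L) else -(n : ZMod L))] := rfl

omit [NeZero L] in
/-- The swapped shifts `(±n, ±m)`. [folklore] -/
private theorem harmonicShift_apply_one (m n : ℕ) (s t : Fin 2) :
    harmonicShift L m n (s, t, 1) =
      ![(if s = 0 then (n : ZMod L) else -(n : ZMod L)), (if t = 0 then (m : ZMod L) else -(m : ZMod L))] := rfl

/-- Bookkeeping: `(½Σa)(½Σb) + (½Σc)(½Σd) = ¼ Σ_{s,t} (a_s b_t + c_s d_t)` over `Fin 2`. [folklore] -/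
private theorem half_sum_mul_half_sum_add (a b c d : Fin 2 → ℂ) :
    ((2 : ℂ)⁻¹ * ∑ s, a s) * ((2 : ℂ)⁻¹ * ∑ t, b t) + ((2 : ℂ)⁻¹ * ∑ s, c s) * ((2 : ℂ)⁻¹ * ∑ t, d t) =
      (4 : ℂ)⁻¹ * ∑ s, ∑ t, (a s * b t + c s * d t) := by
  simp only [Fin.sum_univ_two]
  ring

/-- **Each `C₄ᵥ` harmonic at a lattice momentum is an average of eight characters**:
`h_{m,n}(p_q) = ⅛ Σ_e χ_q(harmonicShift m n e)`. [cite: Salmhofer1999, §4.2.4 (4.59)] -/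
theorem harmonic_latticeMomentum_eq_sum_torusChar (m n : ℕ) (q : TorusSite 2 L) :
    ((TrigPolyC4v.harmonic m n (latticeMomentum L q) : ℝ) : ℂ) =
      (8 : ℂ)⁻¹ * ∑ e : Fin 2 × Fin 2 × Fin 2, torusChar q (harmonicShift L m n e) := by
  have hR : ∑ e : Fin 2 × Fin 2 × Fin 2, torusChar q (harmonicShift L m n e) =
      ∑ s : Fin 2, ∑ t : Fin 2,
        ((ZMod.stdAddChar ((if s = 0 then (m : ZMod L) else -(m : ZMod L)) * q 0) : ℂ) *
            (ZMod.stdAddChar ((if t = 0 then (n : ZMod L) else -(n : ZMod L)) * q 1) : ℂ) +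
          (ZMod.stdAddChar ((if s = 0 then (n : ZMod L) else -(n : ZMod L)) * q 0) : ℂ) *
            (ZMod.stdAddChar ((if t = 0 then (m : ZMod L) else -(m : ZMod L)) * q 1) : ℂ)) := by
    rw [Fintype.sum_prod_type]
    refine sum_congr rfl fun s _ => ?_
    rw [Fintype.sum_prod_type]
    refine sum_congr rfl fun t _ => ?_
    rw [Fin.sum_univ_two, harmonicShift_apply_zero, harmonicShift_apply_one, torusChar_vec2, torusChar_vec2]
  rw [TrigPolyC4v.harmonic, Complex.ofReal_div, Complex.ofReal_add, Complex.ofReal_mul, Complex.ofReal_mul,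
    cos_nat_mul_latticeMomentum_eq_sum m q 0, cos_nat_mul_latticeMomentum_eq_sum n q 1,
    cos_nat_mul_latticeMomentum_eq_sum n q 0, cos_nat_mul_latticeMomentum_eq_sum m q 1, half_sum_mul_half_sum_add, hR]
  push_cast
  ring

/-- **Orthogonality**: `L⁻² Σ_q χ_q(a) conj χ_q(z) = [z = a]`. [folklore] -/
private theorem sum_torusChar_mul_conj_torusChar (a z : TorusSite 2 L) :
    ((L : ℂ) ^ 2)⁻¹ * ∑ q : TorusSite 2 L, torusChar q a * conj (torusChar q z) = if z = a then 1 else 0 := by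
  have hL : ((L : ℂ) ^ 2) ≠ 0 := natCast_pow_ne_zero
  simp_rw [← torusChar_sub_right]
  rw [sum_torusChar_left]
  by_cases h : z = a
  · rw [if_pos h, if_pos (sub_eq_zero.2 h.symm), inv_mul_cancel₀ hL]
  · rw [if_neg h, if_neg (fun h' => h (sub_eq_zero.1 h').symm), mul_zero]

/-- **The position kernel of a harmonic is a combination of eight lattice deltas of weight `⅛`**:
`ȟ_{m,n}(z) = ⅛ Σ_e [z = harmonicShift m n e]`. [cite: Salmhofer1999, §4.2.4 (4.59)] -/
theorem harmonicPosKernel_eq (m n : ℕ) (z : TorusSite 2 L) :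
    harmonicPosKernel L m n z = (8 : ℂ)⁻¹ * ∑ e : Fin 2 × Fin 2 × Fin 2, (if z = harmonicShift L m n e then (1 : ℂ) else 0) := by
  rw [harmonicPosKernel]
  have h1 : ∀ q : TorusSite 2 L, (TrigPolyC4v.harmonic m n (latticeMomentum L q) : ℂ) * conj (torusChar q z) =
      ∑ e : Fin 2 × Fin 2 × Fin 2, (8 : ℂ)⁻¹ * (torusChar q (harmonicShift L m n e) * conj (torusChar q z)) := by
    intro q
    rw [harmonic_latticeMomentum_eq_sum_torusChar, mul_sum, sum_mul]
    exact sum_congr rfl fun e _ => by ring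
  simp_rw [h1]
  rw [sum_comm, mul_sum, mul_sum]
  refine sum_congr rfl fun e _ => ?_
  rw [← sum_torusChar_mul_conj_torusChar, ← mul_sum, mul_left_comm]

/-- `Σ_z ‖ȟ_{m,n}(z)‖ ≤ 1` for every `L` (eight deltas of weight `⅛`; coincidences only help). [cite: BenfattoGiulianiMastropietro2003, §1.2 The model (2.10)] -/
theorem sum_norm_harmonicPosKernel_le (m n : ℕ) : ∑ z : TorusSite 2 L, ‖harmonicPosKernel L m n z‖ ≤ 1 := by
  have hpt : ∀ z : TorusSite 2 L, ‖harmonicPosKernel L m n z‖ ≤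
      (8 : ℝ)⁻¹ * ∑ e : Fin 2 × Fin 2 × Fin 2, (if z = harmonicShift L m n e then (1 : ℝ) else 0) := by
    intro z
    rw [harmonicPosKernel_eq, norm_mul, norm_inv, RCLike.norm_ofNat]
    refine mul_le_mul_of_nonneg_left ((norm_sum_le _ _).trans (sum_le_sum fun e _ => ?_)) (by norm_num)
    split_ifs <;> simp
  calc ∑ z : TorusSite 2 L, ‖harmonicPosKernel L m n z‖
      ≤ ∑ z : TorusSite 2 L, (8 : ℝ)⁻¹ * ∑ e : Fin 2 × Fin 2 × Fin 2, (if z = harmonicShift L m n e then (1 : ℝ) else 0) :=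
        sum_le_sum fun z _ => hpt z
    _ = (8 : ℝ)⁻¹ * ∑ e : Fin 2 × Fin 2 × Fin 2, ∑ z : TorusSite 2 L, (if z = harmonicShift L m n e then (1 : ℝ) else 0) := by
        rw [← mul_sum, sum_comm]
    _ = (8 : ℝ)⁻¹ * ∑ _e : Fin 2 × Fin 2 × Fin 2, (1 : ℝ) := by
        congr 1
        refine sum_congr rfl fun e _ => ?_
        rw [sum_ite_eq' univ (harmonicShift L m n e) (fun _ => (1 : ℝ)), if_pos (mem_univ _)]
    _ = 1 := by simp

/-- **The frame's position kernel is the coefficient combination of the harmonic kernels**: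
`Ǩ_L = Σ_{m,n ≤ d} κ_{m,n} ȟ_{m,n}`. [cite: BenfattoGiulianiMastropietro2003, §1.2 The model (2.10)] -/
theorem framePosKernel_eq_sum (K : TrigPolyC4v) (z : TorusSite 2 L) :
    framePosKernel L K z = ∑ m ∈ range (K.degree + 1), ∑ n ∈ range (K.degree + 1),
      (K.coeff m n : ℂ) * harmonicPosKernel L m n z := by
  have h1 : ∀ q : TorusSite 2 L, (K.eval (latticeMomentum L q) : ℂ) * conj (torusChar q z) =
      ∑ m ∈ range (K.degree + 1), ∑ n ∈ range (K.degree + 1),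
        (K.coeff m n : ℂ) * ((TrigPolyC4v.harmonic m n (latticeMomentum L q) : ℂ) * conj (torusChar q z)) := by
    intro q
    rw [TrigPolyC4v.eval_def, Complex.ofReal_sum, sum_mul]
    refine sum_congr rfl fun m _ => ?_
    rw [Complex.ofReal_sum, sum_mul]
    refine sum_congr rfl fun n _ => ?_
    push_cast
    ring
  rw [framePosKernel]
  simp_rw [h1]
  rw [mul_sum, show (∑ q : TorusSite 2 L, ((L : ℂ) ^ 2)⁻¹ * ∑ m ∈ range (K.degree + 1), ∑ n ∈ range (K.degree + 1),
      (K.coeff m n : ℂ) * ((TrigPolyC4v.harmonic m n (latticeMomentum L q) : ℂ) * conj (torusChar q z))) =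
      ∑ q : TorusSite 2 L, ∑ m ∈ range (K.degree + 1), ∑ n ∈ range (K.degree + 1),
        ((L : ℂ) ^ 2)⁻¹ * ((K.coeff m n : ℂ) * ((TrigPolyC4v.harmonic m n (latticeMomentum L q) : ℂ) * conj (torusChar q z)))
      from sum_congr rfl fun q _ => by rw [mul_sum]; exact sum_congr rfl fun m _ => by rw [mul_sum]]
  rw [sum_comm]
  refine sum_congr rfl fun m _ => ?_
  rw [sum_comm]
  refine sum_congr rfl fun n _ => ?_
  rw [harmonicPosKernel, mul_sum, mul_sum]
  exact sum_congr rfl fun q _ => by ring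

/-- **`Σ_z ‖Ǩ_L(z)‖ ≤ coeffNorm 0 K`** for every `L ≥ 1`: the pinned `ℓ¹` norm of the frame's position kernel is at most
the plain coefficient weight of the frame (each harmonic contributes `ℓ¹` mass `≤ 1`; no volume factor, no condition
`L > 2·degree`). [cite: BenfattoGiulianiMastropietro2003, §1.2 The model (2.10)] -/
theorem sum_norm_framePosKernel_le (K : TrigPolyC4v) : ∑ z : TorusSite 2 L, ‖framePosKernel L K z‖ ≤ K.coeffNorm 0 := by
  simp_rw [framePosKernel_eq_sum]
  calc ∑ z : TorusSite 2 L, ‖∑ m ∈ range (K.degree + 1), ∑ n ∈ range (K.degree + 1), (K.coeff m n : ℂ) * harmonicPosKernel L m n z‖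
      ≤ ∑ z : TorusSite 2 L, ∑ m ∈ range (K.degree + 1), ∑ n ∈ range (K.degree + 1),
          |K.coeff m n| * ‖harmonicPosKernel L m n z‖ := by
        refine sum_le_sum fun z _ => (norm_sum_le _ _).trans (sum_le_sum fun m _ => (norm_sum_le _ _).trans
          (sum_le_sum fun n _ => ?_))
        rw [norm_mul, Complex.norm_real, Real.norm_eq_abs]
    _ = ∑ m ∈ range (K.degree + 1), ∑ n ∈ range (K.degree + 1), |K.coeff m n| * ∑ z : TorusSite 2 L, ‖harmonicPosKernel L m n z‖ := by
        rw [sum_comm]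
        refine sum_congr rfl fun m _ => ?_
        rw [sum_comm]
        refine sum_congr rfl fun n _ => ?_
        rw [mul_sum]
    _ ≤ ∑ m ∈ range (K.degree + 1), ∑ n ∈ range (K.degree + 1), |K.coeff m n| * 1 :=
        sum_le_sum fun m _ => sum_le_sum fun n _ => mul_le_mul_of_nonneg_left (sum_norm_harmonicPosKernel_le m n) (abs_nonneg _)
    _ = K.coeffNorm 0 := by simp [TrigPolyC4v.coeffNorm]

/-- **Spatial orthogonality of the counterterm kernel**: `Σ_{x,y} Ǩ_L(x − y) χ_k(x) conj χ_{k'}(y) = [k = k'] L² K(p_k)`.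
[cite: Salmhofer1999, §4.2.4 (4.59)] -/
theorem sum_sum_framePosKernel_mul_torusChar (K : TrigPolyC4v) (k k' : TorusSite 2 L) :
    ∑ x : TorusSite 2 L, ∑ y : TorusSite 2 L, framePosKernel L K (x - y) * (torusChar k x * conj (torusChar k' y)) =
      if k = k' then (L : ℂ) ^ 2 * (K.eval (latticeMomentum L k) : ℂ) else 0 := by
  have hL : ((L : ℂ) ^ 2) ≠ 0 := natCast_pow_ne_zero
  -- pointwise expansion `Ǩ(x - y) χ_k(x) conj χ_{k'}(y) = L⁻² Σ_q K(p_q) χ_{k-q}(x) χ_{q-k'}(y)`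
  have hT : ∀ x y : TorusSite 2 L, framePosKernel L K (x - y) * (torusChar k x * conj (torusChar k' y)) =
      ∑ q : TorusSite 2 L, ((L : ℂ) ^ 2)⁻¹ * (K.eval (latticeMomentum L q) : ℂ) * (torusChar (k - q) x * torusChar (q - k') y) := by
    intro x y
    rw [framePosKernel, mul_sum, sum_mul]
    refine sum_congr rfl fun q _ => ?_
    rw [torusChar_sub_right, map_mul, starRingEnd_self_apply, torusChar_sub_left, torusChar_sub_left]
    ring
  simp_rw [hT]
  rw [show (∑ x : TorusSite 2 L, ∑ y : TorusSite 2 L, ∑ q : TorusSite 2 L,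
      ((L : ℂ) ^ 2)⁻¹ * (K.eval (latticeMomentum L q) : ℂ) * (torusChar (k - q) x * torusChar (q - k') y)) =
      ∑ x : TorusSite 2 L, ∑ q : TorusSite 2 L, ∑ y : TorusSite 2 L,
        ((L : ℂ) ^ 2)⁻¹ * (K.eval (latticeMomentum L q) : ℂ) * (torusChar (k - q) x * torusChar (q - k') y)
      from sum_congr rfl fun x _ => sum_comm, sum_comm]
  -- the `x`- and `y`-sums are character orthogonality relations
  have hq : ∀ q : TorusSite 2 L, ∑ x : TorusSite 2 L, ∑ y : TorusSite 2 L,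
      ((L : ℂ) ^ 2)⁻¹ * (K.eval (latticeMomentum L q) : ℂ) * (torusChar (k - q) x * torusChar (q - k') y) =
        ((L : ℂ) ^ 2)⁻¹ * (K.eval (latticeMomentum L q) : ℂ) *
          ((∑ x : TorusSite 2 L, torusChar (k - q) x) * ∑ y : TorusSite 2 L, torusChar (q - k') y) := by
    intro q
    rw [sum_mul_sum, mul_sum]
    exact sum_congr rfl fun x _ => by rw [mul_sum]
  simp_rw [hq, sum_torusChar_right]
  -- only `q = k` survives, and then only if `k = k'`
  have hpt : ∀ q : TorusSite 2 L, ((L : ℂ) ^ 2)⁻¹ * (K.eval (latticeMomentum L q) : ℂ) *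
      ((if k - q = 0 then (L : ℂ) ^ 2 else 0) * (if q - k' = 0 then (L : ℂ) ^ 2 else 0)) =
        if q = k then (if k = k' then (L : ℂ) ^ 2 * (K.eval (latticeMomentum L k) : ℂ) else 0) else 0 := by
    intro q
    by_cases h1 : q = k
    · subst h1
      rw [if_pos (sub_self q), if_pos rfl]
      by_cases h2 : q = k'
      · rw [if_pos (sub_eq_zero.2 h2), if_pos h2]
        field_simp
      · rw [if_neg (fun h => h2 (sub_eq_zero.1 h)), mul_zero, mul_zero, if_neg h2]
    · rw [if_neg (fun h => h1 (sub_eq_zero.1 h).symm), zero_mul, mul_zero, if_neg h1]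
  simp_rw [hpt]
  rw [sum_ite_eq' univ k, if_pos (mem_univ _)]

end PositionKernel

/-! ### §2 The grid counterterm and its exact image -/

section Grid

variable (L : ℕ) [NeZero L] (M N : ℕ)

/-- **The grid image of the counterterm vertex**: the time-LOCAL, space-nonlocal quadratic polynomial
`𝒩_{K,N} = ε_N Σ_σ Σ_{(j,x⃗), y⃗} Ǩ_L(x⃗ − y⃗) ψ⁺_{((j,x⃗),σ)} ψ⁻_{((j,y⃗),σ)}` on the `N`-point time grid (`ε_N = β/N`; the Riemann sum of
`∫₀^β dτ Σ_{x⃗,y⃗} Ǩ_L(x⃗ − y⃗) ψ⁺_{(x⃗,τ)σ} ψ⁻_{(y⃗,τ)σ}`; indexed by `σ` and the pair `((j, x⃗), y⃗) ∈ GridPoint L N × (ℤ/Lℤ)²`).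
[cite: BenfattoGiulianiMastropietro2003, §1.2 The model (2.10)] -/
def hubbardGridCounterQuadratic (β : ℝ) (K : TrigPolyC4v) : GrassmannAlgebra ℂ (GridLeg (GridPoint L N)) :=
  (((β / N : ℝ)) : ℂ) • ∑ σ : Fin 2, ∑ py : GridPoint L N × TorusSite 2 L,
    framePosKernel L K (py.1.2 - py.2) •
      (gen ℂ (((py.1, σ), 0) : GridLeg (GridPoint L N)) * gen ℂ ((((py.1.1, py.2), σ), 1) : GridLeg (GridPoint L N)))

variable {L M N}

/-- The grid counterterm has no constant part. [cite: BenfattoGiulianiMastropietro2003, §1.2 The model (2.10)] -/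
theorem constPart_hubbardGridCounterQuadratic (β : ℝ) (K : TrigPolyC4v) :
    constPart ℂ (hubbardGridCounterQuadratic L N β K) = 0 := by
  simp [hubbardGridCounterQuadratic, map_sum]

/-- **The product of a `ψ⁺` and a `ψ⁻` position–time field, expanded in momentum monomials**:
`ψ^c_{(x,s)σ} ψ^{c'}_{(y,t)σ'} = Σ_{k,k'} a_k(x,s) a'_{k'}(y,t) · ψ̂^c_{kσ} ψ̂^{c'}_{k'σ'}`. [cite: BenfattoGiulianiMastropietro2006, §2.1 (2.5)] -/
theorem positionField_mul_positionField (β : ℝ) (c c' σ σ' : Fin 2) (x y : TorusSite 2 L) (s t : ℝ) :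
    positionField L M β c σ x s * positionField L M β c' σ' y t =
      ∑ k : FreqMomentum L M, ∑ k' : FreqMomentum L M,
        ((((1 / (β * (L : ℝ) ^ 2) : ℝ) : ℂ) * conj (vertexPlaneWave L M β c k x s)) *
          (((1 / (β * (L : ℝ) ^ 2) : ℝ) : ℂ) * conj (vertexPlaneWave L M β c' k' y t))) •
          (gen ℂ (((k, σ), c) : HubbardFieldIdx L M) * gen ℂ (((k', σ'), c') : HubbardFieldIdx L M)) := by
  rw [positionField, positionField, sum_mul_sum]
  refine sum_congr rfl fun k _ => sum_congr rfl fun k' _ => ?_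
  rw [smul_mul_smul_comm]

/-- The two leg phases of a quadratic monomial at one time: `conj(e^{-ik·(x,t)}) conj(e^{+ik'·(y,t)}) = e^{2πi(n−n')t/β} χ_{k⃗}(x⃗) conj χ_{k⃗'}(y⃗)`
(`n, n'` the integer Matsubara labels; the half-integer offsets cancel). [cite: BenfattoGiulianiMastropietro2006, §2.1 (2.5)] -/
theorem conj_vertexPlaneWave_zero_mul_one_eq (β : ℝ) (k k' : FreqMomentum L M) (x y : TorusSite 2 L) (t : ℝ) :
    conj (vertexPlaneWave L M β 0 k x t) * conj (vertexPlaneWave L M β 1 k' y t) =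
      Complex.exp (((2 * Real.pi * ((matsubaraInt M k.1 - matsubaraInt M k'.1 : ℤ) : ℝ) * t / β : ℝ) : ℂ) * Complex.I) *
        (torusChar k.2 x * conj (torusChar k'.2 y)) := by
  rw [conj_vertexPlaneWave_zero_eq, conj_vertexPlaneWave_one_eq]
  have hfreq : Complex.exp (((matsubaraFreq β M k.1 * t : ℝ) : ℂ) * Complex.I) *
      Complex.exp (-(((matsubaraFreq β M k'.1 * t : ℝ) : ℂ) * Complex.I)) =
      Complex.exp (((2 * Real.pi * ((matsubaraInt M k.1 - matsubaraInt M k'.1 : ℤ) : ℝ) * t / β : ℝ) : ℂ) * Complex.I) := by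
    rw [← Complex.exp_add]
    rcases eq_or_ne β 0 with hβ | hβ
    · subst hβ
      simp [matsubaraFreq]
    · congr 1
      simp only [matsubaraFreq]
      push_cast
      field_simp
      ring
  rw [← hfreq]
  ring

/-- The frequency transfer of a quadratic monomial is at most `2M − 1` in modulus. [cite: Salmhofer1999, §4.2.4 (4.63)] -/
theorem natAbs_matsubaraInt_sub_lt (i i' : MatsubaraIdx M) : (matsubaraInt M i - matsubaraInt M i').natAbs < 2 * M := by
  have hi := i.isLt
  have hi' := i'.isLt
  simp only [matsubaraInt]
  omega

/-- The integer Matsubara label determines the index. [folklore] -/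
private theorem matsubaraInt_sub_eq_zero_iff (i i' : MatsubaraIdx M) : matsubaraInt M i - matsubaraInt M i' = 0 ↔ i = i' := by
  simp only [matsubaraInt]
  constructor
  · intro h
    exact Fin.ext (by omega)
  · intro h
    rw [h, sub_self]

/-- **The time sum of a quadratic monomial on the grid is the frequency constraint** (`2M ≤ N`, `β ≠ 0`):
`Σ_{j<N} conj(e^{-ik·(x,τ_j)}) conj(e^{ik'·(y,τ_j)}) = N·[n = n']·χ_{k⃗}(x⃗) conj χ_{k⃗'}(y⃗)`. [cite: Salmhofer1999, §4.2.4 (4.59)] -/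
theorem sum_conj_vertexPlaneWave_zero_mul_one_gridTime {β : ℝ} (hβ : β ≠ 0) (hN : 2 * M ≤ N) (k k' : FreqMomentum L M)
    (x y : TorusSite 2 L) :
    ∑ j : Fin N, conj (vertexPlaneWave L M β 0 k x (gridTime β N j)) * conj (vertexPlaneWave L M β 1 k' y (gridTime β N j)) =
      (if k.1 = k'.1 then (N : ℂ) else 0) * (torusChar k.2 x * conj (torusChar k'.2 y)) := by
  simp_rw [conj_vertexPlaneWave_zero_mul_one_eq]
  rw [← sum_mul, sum_exp_freqTransfer_gridTime hβ (lt_of_lt_of_le (natAbs_matsubaraInt_sub_lt k.1 k'.1) hN)]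
  simp only [matsubaraInt_sub_eq_zero_iff]

/-- **The counterterm vertex is time-local on the `N`-point grid, `N ≥ 2M`**:
`map (toLin' S_N) 𝒩_{K,N} = counterQuadratic L M β K` (`β ≠ 0`).  Each grid monomial expands as
`(βL²)⁻² Σ_{k,k'} conj(e^{-ik·(x,τ_j)}) conj(e^{ik'·(y,τ_j)}) ψ̂⁺_{kσ}ψ̂⁻_{k'σ}`; the time sum gives `N[n = n']` (`|n − n'| ≤ 2M − 1 < N`,
`sum_exp_freqTransfer_gridTime`), the spatial double sum against `Ǩ_L(x − y)` gives `L² K(p_k)[k⃗ = k⃗']`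
(`sum_sum_framePosKernel_mul_torusChar`), and `ε_N (βL²)⁻² N L² = (βL²)⁻¹` is the coefficient of `counterQuadratic`.
[cite: BenfattoGiulianiMastropietro2003, §1.2 The model (2.10)] -/
theorem map_hubbardGridSub_gridCounterQuadratic {β : ℝ} (hβ : β ≠ 0) (K : TrigPolyC4v) (hN : 2 * M ≤ N) [NeZero N] :
    ExteriorAlgebra.map (Matrix.toLin' (hubbardGridSub L M β N)) (hubbardGridCounterQuadratic L N β K) =
      counterQuadratic L M β K := by
  have hNc : (N : ℂ) ≠ 0 := by exact_mod_cast NeZero.ne N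
  have hLc : (L : ℂ) ≠ 0 := by exact_mod_cast NeZero.ne L
  have hβc : (β : ℂ) ≠ 0 := by exact_mod_cast hβ
  -- the scalar coefficient of the monomial `ψ̂⁺_{kσ} ψ̂⁻_{k'σ}` contributed by the grid point `((j, x), y)`
  set F : FreqMomentum L M → FreqMomentum L M → GridPoint L N × TorusSite 2 L → ℂ := fun k k' py =>
    (((β / N : ℝ)) : ℂ) * (framePosKernel L K (py.1.2 - py.2) *
      ((((1 / (β * (L : ℝ) ^ 2) : ℝ) : ℂ) * conj (vertexPlaneWave L M β 0 k py.1.2 (gridTime β N py.1.1))) *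
        (((1 / (β * (L : ℝ) ^ 2) : ℝ) : ℂ) * conj (vertexPlaneWave L M β 1 k' py.2 (gridTime β N py.1.1))))) with hF
  -- Step 1: the image as a triple sum `Σ_σ Σ_k Σ_k' (Σ_py F) • ψ̂⁺_{kσ} ψ̂⁻_{k'σ}`
  have h1 : ExteriorAlgebra.map (Matrix.toLin' (hubbardGridSub L M β N)) (hubbardGridCounterQuadratic L N β K) =
      ∑ σ : Fin 2, ∑ k : FreqMomentum L M, ∑ k' : FreqMomentum L M,
        (∑ py : GridPoint L N × TorusSite 2 L, F k k' py) • (psiPlus k σ * psiMinus k' σ) := by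
    rw [hubbardGridCounterQuadratic, map_smul, map_sum, smul_sum]
    refine sum_congr rfl fun σ _ => ?_
    rw [map_sum, smul_sum]
    simp only [map_smul, map_mul, hubbardGridSub, map_gridSub_gen]
    simp only [positionField_mul_positionField, smul_sum, smul_smul]
    -- now `Σ_py Σ_k Σ_k' (…) • (…)`: bring `k`, `k'` out and collect the `py`-sum
    rw [sum_comm]
    refine sum_congr rfl fun k _ => ?_
    rw [show (∑ py : GridPoint L N × TorusSite 2 L, ∑ k' : FreqMomentum L M,
        ((((β / N : ℝ)) : ℂ) * (framePosKernel L K (py.1.2 - py.2) *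
          ((((1 / (β * (L : ℝ) ^ 2) : ℝ) : ℂ) * conj (vertexPlaneWave L M β 0 k py.1.2 (gridTime β N py.1.1))) *
            (((1 / (β * (L : ℝ) ^ 2) : ℝ) : ℂ) * conj (vertexPlaneWave L M β 1 k' py.2 (gridTime β N py.1.1)))))) •
          (gen ℂ (((k, σ), 0) : HubbardFieldIdx L M) * gen ℂ (((k', σ), 1) : HubbardFieldIdx L M))) =
        ∑ k' : FreqMomentum L M, ∑ py : GridPoint L N × TorusSite 2 L,
          F k k' py • (gen ℂ (((k, σ), 0) : HubbardFieldIdx L M) * gen ℂ (((k', σ), 1) : HubbardFieldIdx L M))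
        from sum_comm]
    refine sum_congr rfl fun k' _ => ?_
    rw [← sum_smul]
    rfl
  -- Step 2: the `py`-sum of `F` is the constraint `[k = k'] K(p_k)/(βL²)`
  have h2 : ∀ k k' : FreqMomentum L M, ∑ py : GridPoint L N × TorusSite 2 L, F k k' py =
      if k' = k then ((K.eval (latticeMomentum L k.2) / (β * (L : ℝ) ^ 2) : ℝ) : ℂ) else 0 := by
    intro k k'
    have hfac : ∀ py : GridPoint L N × TorusSite 2 L, F k k' py =
        ((((β / N : ℝ)) : ℂ) * (((1 / (β * (L : ℝ) ^ 2) : ℝ) : ℂ)) ^ 2) *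
          (framePosKernel L K (py.1.2 - py.2) *
            (conj (vertexPlaneWave L M β 0 k py.1.2 (gridTime β N py.1.1)) *
              conj (vertexPlaneWave L M β 1 k' py.2 (gridTime β N py.1.1)))) := by
      intro py
      rw [hF]
      ring
    simp_rw [hfac]
    rw [← mul_sum, Fintype.sum_prod_type, Fintype.sum_prod_type]
    -- `Σ_j Σ_x Σ_y Ǩ(x-y) φ⁺ φ⁻`: do the time sum first
    have htime : ∀ x y : TorusSite 2 L, ∑ j : Fin N, framePosKernel L K (x - y) *
        (conj (vertexPlaneWave L M β 0 k x (gridTime β N j)) * conj (vertexPlaneWave L M β 1 k' y (gridTime β N j))) =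
        (if k.1 = k'.1 then (N : ℂ) else 0) * (framePosKernel L K (x - y) * (torusChar k.2 x * conj (torusChar k'.2 y))) := by
      intro x y
      rw [← mul_sum, sum_conj_vertexPlaneWave_zero_mul_one_gridTime hβ hN]
      ring
    rw [show (∑ j : Fin N, ∑ x : TorusSite 2 L, ∑ y : TorusSite 2 L, framePosKernel L K ((j, x).2 - y) *
        (conj (vertexPlaneWave L M β 0 k (j, x).2 (gridTime β N (j, x).1)) *
          conj (vertexPlaneWave L M β 1 k' y (gridTime β N (j, x).1)))) =
        ∑ x : TorusSite 2 L, ∑ y : TorusSite 2 L, ∑ j : Fin N, framePosKernel L K (x - y) *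
          (conj (vertexPlaneWave L M β 0 k x (gridTime β N j)) * conj (vertexPlaneWave L M β 1 k' y (gridTime β N j)))
        by rw [sum_comm]; exact sum_congr rfl fun x _ => sum_comm]
    simp_rw [htime]
    simp_rw [← mul_sum]
    rw [sum_sum_framePosKernel_mul_torusChar]
    by_cases hk : k' = k
    · subst hk
      rw [if_pos rfl, if_pos rfl, if_pos rfl]
      push_cast
      field_simp
    · rw [if_neg hk]
      by_cases h1 : k.1 = k'.1
      · have h2 : k.2 ≠ k'.2 := fun h => hk (Prod.ext h1.symm h.symm)
        rw [if_neg h2, mul_zero, mul_zero]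
      · rw [if_neg h1, zero_mul, mul_zero]
  -- Step 3: collapse the `k'`-sum and compare with `counterQuadratic`
  rw [h1, counterQuadratic, sum_comm]
  refine sum_congr rfl fun k _ => sum_congr rfl fun σ _ => ?_
  rw [show (∑ k' : FreqMomentum L M, (∑ py : GridPoint L N × TorusSite 2 L, F k k' py) • (psiPlus k σ * psiMinus k' σ)) =
      ∑ k' : FreqMomentum L M, (if k' = k then ((K.eval (latticeMomentum L k.2) / (β * (L : ℝ) ^ 2) : ℝ) : ℂ) else 0) •
        (psiPlus k σ * psiMinus k' σ) from sum_congr rfl fun k' _ => by rw [h2 k k']]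
  simp_rw [ite_smul, zero_smul]
  rw [sum_ite_eq' univ k, if_pos (mem_univ _)]

end Grid

/-! ### §3 Kernels: the `2`-point kernel of a structured quadratic polynomial and its pinned `ℓ¹` sums -/

section Kernels

variable {Γ : Type*} [DecidableEq Γ]

/-- `ψ(a) ψ(b) = genProd ![a, b]`. [folklore] -/
private theorem gen_mul_gen_eq_genProd (a b : Γ) : gen ℂ a * gen ℂ b = genProd ℂ ![a, b] := by
  rw [genProd_succ, genProd_succ, genProd_zero, mul_one]
  rfl

/-- **The `2`-point kernel of `ψ(a)ψ(b)`**: `kernel (ψ(a)ψ(b)) 2 Y = ½([Y₀ = a][Y₁ = b] − [Y₀ = b][Y₁ = a])`.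
[cite: Salmhofer1999, §4.3 (4.95)] -/
theorem kernel_two_gen_mul_gen (a b : Γ) (Y : Fin 2 → Γ) :
    kernel ℂ (gen ℂ a * gen ℂ b) 2 Y =
      (2 : ℂ)⁻¹ * ((if Y 0 = a then 1 else 0) * (if Y 1 = b then 1 else 0) - (if Y 0 = b then 1 else 0) * (if Y 1 = a then 1 else 0)) := by
  rw [gen_mul_gen_eq_genProd, kernel_genProd, Matrix.det_fin_two]
  simp only [deltaMatrix_apply, Matrix.cons_val_zero, Matrix.cons_val_one, Nat.factorial_two,
    Nat.cast_ofNat, Rat.smul_one_eq_cast, Rat.cast_inv, Rat.cast_ofNat]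
  congr

/-- The kernels of `ψ(a)ψ(b)` in degrees `≠ 2` vanish. [cite: Salmhofer1999, §4.3 (4.95)] -/
theorem kernel_gen_mul_gen_of_ne (a b : Γ) {m : ℕ} (hm : m ≠ 2) (Y : Fin m → Γ) : kernel ℂ (gen ℂ a * gen ℂ b) m Y = 0 := by
  rw [gen_mul_gen_eq_genProd, kernel_genProd_of_ne ℂ Y _ hm]

/-- The norm of the `2`-point kernel of `ψ(a)ψ(b)`: `≤ ½([Y = (a,b)] + [Y = (b,a)])`. [cite: Salmhofer1999, §4.3 (4.95)] -/
theorem norm_kernel_two_gen_mul_gen_le (a b : Γ) (Y : Fin 2 → Γ) :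
    ‖kernel ℂ (gen ℂ a * gen ℂ b) 2 Y‖ ≤
      2⁻¹ * ((if Y = ![a, b] then (1 : ℝ) else 0) + (if Y = ![b, a] then (1 : ℝ) else 0)) := by
  have hvec : ∀ u v : Γ, (Y 0 = u ∧ Y 1 = v) ↔ Y = ![u, v] := by
    intro u v
    constructor
    · rintro ⟨h0, h1⟩
      funext i
      fin_cases i
      · simpa using h0
      · simpa using h1
    · intro h
      subst h
      simp
  rw [kernel_two_gen_mul_gen, norm_mul, norm_inv, RCLike.norm_ofNat]
  refine mul_le_mul_of_nonneg_left ((norm_sub_le _ _).trans (add_le_add ?_ ?_)) (by norm_num)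
  · by_cases h : Y 0 = a ∧ Y 1 = b
    · rw [if_pos h.1, if_pos h.2, if_pos ((hvec a b).1 h)]; simp
    · rw [if_neg ((hvec a b).not.1 h)]
      rcases not_and_or.1 h with h' | h'
      · rw [if_neg h']; simp
      · rw [if_neg h']; simp
  · by_cases h : Y 0 = b ∧ Y 1 = a
    · rw [if_pos h.1, if_pos h.2, if_pos ((hvec b a).1 h)]; simp
    · rw [if_neg ((hvec b a).not.1 h)]
      rcases not_and_or.1 h with h' | h'
      · rw [if_neg h']; simp
      · rw [if_neg h']; simp

/-- The pinned count of one ordered pair: `Σ_{Y : Y p = w} [Y = v] = [v p = w]`. [folklore] -/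
private theorem sum_filter_ite_eq_vec [Fintype Γ] (p : Fin 2) (w : Γ) (v : Fin 2 → Γ) :
    ∑ Y ∈ univ.filter (fun Y : Fin 2 → Γ => Y p = w), (if Y = v then (1 : ℝ) else 0) = if v p = w then 1 else 0 := by
  rw [sum_ite_eq' (univ.filter fun Y : Fin 2 → Γ => Y p = w) v (fun _ => (1 : ℝ))]
  simp only [mem_filter, mem_univ, true_and]

/-- **Pinned `ℓ¹` sums of the `2`-point kernel of a structured quadratic polynomial**
`Q = Σ_{i ∈ s} c_i ψ(a_i) ψ(b_i)`: if for every leg `w` the coefficients with `a_i = w`, resp. `b_i = w`, have total size `≤ B`, then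
`Σ_{Y : Y p = w} ‖kernel Q 2 Y‖ ≤ B` for both slots `p` and every `w` (the antisymmetrisation's `½` pays for the two orderings).
[cite: Salmhofer1999, §4.3 (4.95)] -/
theorem sum_norm_kernel_two_structured_le [Fintype Γ] {ι : Type*} (s : Finset ι) (c : ι → ℂ) (a b : ι → Γ) {B : ℝ}
    (ha : ∀ w : Γ, ∑ i ∈ s.filter (fun i => a i = w), ‖c i‖ ≤ B) (hb : ∀ w : Γ, ∑ i ∈ s.filter (fun i => b i = w), ‖c i‖ ≤ B)
    (p : Fin 2) (w : Γ) :
    ∑ Y ∈ univ.filter (fun Y : Fin 2 → Γ => Y p = w), ‖kernel ℂ (∑ i ∈ s, c i • (gen ℂ (a i) * gen ℂ (b i))) 2 Y‖ ≤ B := by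
  have hB : 0 ≤ B := (sum_nonneg fun i _ => norm_nonneg (c i)).trans (ha w)
  -- pointwise: `‖kernel Q 2 Y‖ ≤ Σ_i ‖c_i‖ · ½([Y = (a_i,b_i)] + [Y = (b_i,a_i)])`
  have hpt : ∀ Y : Fin 2 → Γ, ‖kernel ℂ (∑ i ∈ s, c i • (gen ℂ (a i) * gen ℂ (b i))) 2 Y‖ ≤
      ∑ i ∈ s, ‖c i‖ * (2⁻¹ * ((if Y = ![a i, b i] then (1 : ℝ) else 0) + (if Y = ![b i, a i] then (1 : ℝ) else 0))) := by
    intro Y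
    rw [kernel_sum]
    refine (norm_sum_le _ _).trans (sum_le_sum fun i _ => ?_)
    rw [kernel_smul, norm_mul]
    exact mul_le_mul_of_nonneg_left (norm_kernel_two_gen_mul_gen_le (a i) (b i) Y) (norm_nonneg _)
  calc ∑ Y ∈ univ.filter (fun Y : Fin 2 → Γ => Y p = w), ‖kernel ℂ (∑ i ∈ s, c i • (gen ℂ (a i) * gen ℂ (b i))) 2 Y‖
      ≤ ∑ Y ∈ univ.filter (fun Y : Fin 2 → Γ => Y p = w),
          ∑ i ∈ s, ‖c i‖ * (2⁻¹ * ((if Y = ![a i, b i] then (1 : ℝ) else 0) + (if Y = ![b i, a i] then (1 : ℝ) else 0))) :=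
        sum_le_sum fun Y _ => hpt Y
    _ = ∑ i ∈ s, ‖c i‖ * (2⁻¹ * ((if ![a i, b i] p = w then (1 : ℝ) else 0) + (if ![b i, a i] p = w then (1 : ℝ) else 0))) := by
        rw [sum_comm]
        refine sum_congr rfl fun i _ => ?_
        rw [← mul_sum, ← mul_sum, sum_add_distrib, sum_filter_ite_eq_vec, sum_filter_ite_eq_vec]
    _ = 2⁻¹ * (∑ i ∈ s.filter (fun i => ![a i, b i] p = w), ‖c i‖ + ∑ i ∈ s.filter (fun i => ![b i, a i] p = w), ‖c i‖) := by
        rw [sum_filter, sum_filter, ← sum_add_distrib, mul_sum]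
        refine sum_congr rfl fun i _ => ?_
        split_ifs <;> ring
    _ ≤ 2⁻¹ * (B + B) := by
        refine mul_le_mul_of_nonneg_left (add_le_add ?_ ?_) (by norm_num)
        · fin_cases p
          · calc ∑ i ∈ s.filter (fun i => ![a i, b i] (⟨0, by norm_num⟩ : Fin 2) = w), ‖c i‖
                = ∑ i ∈ s.filter (fun i => a i = w), ‖c i‖ := by
                  congr 1
              _ ≤ B := ha w
          · calc ∑ i ∈ s.filter (fun i => ![a i, b i] (⟨1, by norm_num⟩ : Fin 2) = w), ‖c i‖
                = ∑ i ∈ s.filter (fun i => b i = w), ‖c i‖ := by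
                  congr 1
              _ ≤ B := hb w
        · fin_cases p
          · calc ∑ i ∈ s.filter (fun i => ![b i, a i] (⟨0, by norm_num⟩ : Fin 2) = w), ‖c i‖
                = ∑ i ∈ s.filter (fun i => b i = w), ‖c i‖ := by
                  congr 1
              _ ≤ B := hb w
          · calc ∑ i ∈ s.filter (fun i => ![b i, a i] (⟨1, by norm_num⟩ : Fin 2) = w), ‖c i‖
                = ∑ i ∈ s.filter (fun i => a i = w), ‖c i‖ := by
                  congr 1
              _ ≤ B := ha w
    _ = B := by ring

/-- The kernels of a structured quadratic polynomial in degrees `≠ 2` vanish. [cite: Salmhofer1999, §4.3 (4.95)] -/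
theorem kernel_two_structured_of_ne {ι : Type*} (s : Finset ι) (c : ι → ℂ) (a b : ι → Γ) {m : ℕ} (hm : m ≠ 2)
    (Y : Fin m → Γ) : kernel ℂ (∑ i ∈ s, c i • (gen ℂ (a i) * gen ℂ (b i))) m Y = 0 := by
  rw [kernel_sum]
  exact sum_eq_zero fun i _ => by rw [kernel_smul, kernel_gen_mul_gen_of_ne (a i) (b i) hm, mul_zero]

end Kernels

/-! ### §3′ The pinned `ℓ¹` kernel norm of the grid counterterm -/

section CounterKernels

variable {L N : ℕ} [NeZero L]

/-- The grid counterterm as ONE structured sum over `ι = Fin 2 × (GridPoint L N × (ℤ/Lℤ)²)` (the shape of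
`sum_norm_kernel_two_structured_le`). [cite: BenfattoGiulianiMastropietro2003, §1.2 The model (2.10)] -/
theorem hubbardGridCounterQuadratic_eq_sum (β : ℝ) (K : TrigPolyC4v) :
    hubbardGridCounterQuadratic L N β K = ∑ i : Fin 2 × (GridPoint L N × TorusSite 2 L),
      ((((β / N : ℝ)) : ℂ) * framePosKernel L K (i.2.1.2 - i.2.2)) •
        (gen ℂ (((i.2.1, i.1), 0) : GridLeg (GridPoint L N)) * gen ℂ ((((i.2.1.1, i.2.2), i.1), 1) : GridLeg (GridPoint L N))) := by
  rw [hubbardGridCounterQuadratic, smul_sum, Fintype.sum_prod_type]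
  refine sum_congr rfl fun σ _ => ?_
  rw [smul_sum]
  exact sum_congr rfl fun py _ => by rw [smul_smul]

/-- **The `ψ⁺`-pinned coefficient sum of the grid counterterm**: for every leg `w`, the coefficients of the monomials whose `ψ⁺` leg
is `w` have total size `≤ (|β|/N)·coeffNorm 0 K` (they are `ε_N Ǩ_L(x⃗_w − y⃗)`, `y⃗ ∈ (ℤ/Lℤ)²`). [cite: BenfattoGiulianiMastropietro2003, §1.2 The model (2.10)] -/
theorem sum_filter_plusLeg_norm_coeff_le (β : ℝ) (K : TrigPolyC4v) (w : GridLeg (GridPoint L N)) :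
    ∑ i ∈ (univ : Finset (Fin 2 × (GridPoint L N × TorusSite 2 L))).filter
        (fun i => ((((i.2.1, i.1), 0) : GridLeg (GridPoint L N))) = w),
      ‖(((β / N : ℝ)) : ℂ) * framePosKernel L K (i.2.1.2 - i.2.2)‖ ≤ |β| / N * K.coeffNorm 0 := by
  set s := (univ : Finset (Fin 2 × (GridPoint L N × TorusSite 2 L))).filter
    (fun i => ((((i.2.1, i.1), 0) : GridLeg (GridPoint L N))) = w) with hs
  -- on `s`, the point `i.2.1` is `w.1.1`, so the summand is a function of `y = i.2.2`, and `i ↦ i.2.2` is injective on `s`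
  have hmem : ∀ i ∈ s, i.2.1 = w.1.1 ∧ i.1 = w.1.2 := by
    intro i hi
    rw [hs, mem_filter] at hi
    have h := hi.2
    exact ⟨by rw [← h], by rw [← h]⟩
  have hinj : Set.InjOn (fun i : Fin 2 × (GridPoint L N × TorusSite 2 L) => i.2.2) s := by
    intro i hi i' hi' h
    obtain ⟨h1, h2⟩ := hmem i hi
    obtain ⟨h1', h2'⟩ := hmem i' hi'
    exact Prod.ext (h2.trans h2'.symm) (Prod.ext (h1.trans h1'.symm) h)
  set g : TorusSite 2 L → ℝ := fun y => |β| / N * ‖framePosKernel L K (w.1.1.2 - y)‖ with hg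
  have hcongr : ∀ i ∈ s, ‖(((β / N : ℝ)) : ℂ) * framePosKernel L K (i.2.1.2 - i.2.2)‖ = g i.2.2 := by
    intro i hi
    rw [hg, (hmem i hi).1, norm_mul, Complex.norm_real, Real.norm_eq_abs, abs_div, Nat.abs_cast]
  have hg0 : ∀ y, 0 ≤ g y := fun y => by rw [hg]; positivity
  calc ∑ i ∈ s, ‖(((β / N : ℝ)) : ℂ) * framePosKernel L K (i.2.1.2 - i.2.2)‖ = ∑ i ∈ s, g i.2.2 := sum_congr rfl hcongr
    _ = ∑ y ∈ s.image (fun i : Fin 2 × (GridPoint L N × TorusSite 2 L) => i.2.2), g y := (sum_image hinj).symm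
    _ ≤ ∑ y : TorusSite 2 L, g y := sum_le_sum_of_subset_of_nonneg (subset_univ _) fun y _ _ => hg0 y
    _ = |β| / N * ∑ z : TorusSite 2 L, ‖framePosKernel L K z‖ := by
        rw [hg, ← mul_sum]
        congr 1
        exact Fintype.sum_equiv (Equiv.subLeft w.1.1.2) _ _ fun y => by simp [Equiv.subLeft]
    _ ≤ |β| / N * K.coeffNorm 0 := mul_le_mul_of_nonneg_left (sum_norm_framePosKernel_le K) (by positivity)

/-- **The `ψ⁻`-pinned coefficient sum of the grid counterterm**: for every leg `w`, the coefficients of the monomials whose `ψ⁻` leg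
is `w` have total size `≤ (|β|/N)·coeffNorm 0 K` (they are `ε_N Ǩ_L(x⃗ − y⃗_w)`, `x⃗ ∈ (ℤ/Lℤ)²`). [cite: BenfattoGiulianiMastropietro2003, §1.2 The model (2.10)] -/
theorem sum_filter_minusLeg_norm_coeff_le (β : ℝ) (K : TrigPolyC4v) (w : GridLeg (GridPoint L N)) :
    ∑ i ∈ (univ : Finset (Fin 2 × (GridPoint L N × TorusSite 2 L))).filter
        (fun i => (((((i.2.1.1, i.2.2), i.1), 1) : GridLeg (GridPoint L N))) = w),
      ‖(((β / N : ℝ)) : ℂ) * framePosKernel L K (i.2.1.2 - i.2.2)‖ ≤ |β| / N * K.coeffNorm 0 := by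
  set s := (univ : Finset (Fin 2 × (GridPoint L N × TorusSite 2 L))).filter
    (fun i => (((((i.2.1.1, i.2.2), i.1), 1) : GridLeg (GridPoint L N))) = w) with hs
  -- on `s`, the time `i.2.1.1`, the point `i.2.2` and the spin are those of `w`; `i ↦ i.2.1.2` is injective on `s`
  have hmem : ∀ i ∈ s, i.2.1.1 = w.1.1.1 ∧ i.2.2 = w.1.1.2 ∧ i.1 = w.1.2 := by
    intro i hi
    rw [hs, mem_filter] at hi
    have h := hi.2
    exact ⟨by rw [← h], by rw [← h], by rw [← h]⟩
  have hinj : Set.InjOn (fun i : Fin 2 × (GridPoint L N × TorusSite 2 L) => i.2.1.2) s := by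
    intro i hi i' hi' h
    obtain ⟨h1, h2, h3⟩ := hmem i hi
    obtain ⟨h1', h2', h3'⟩ := hmem i' hi'
    exact Prod.ext (h3.trans h3'.symm) (Prod.ext (Prod.ext (h1.trans h1'.symm) h) (h2.trans h2'.symm))
  set g : TorusSite 2 L → ℝ := fun x => |β| / N * ‖framePosKernel L K (x - w.1.1.2)‖ with hg
  have hcongr : ∀ i ∈ s, ‖(((β / N : ℝ)) : ℂ) * framePosKernel L K (i.2.1.2 - i.2.2)‖ = g i.2.1.2 := by
    intro i hi
    rw [hg, (hmem i hi).2.1, norm_mul, Complex.norm_real, Real.norm_eq_abs, abs_div, Nat.abs_cast]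
  have hg0 : ∀ x, 0 ≤ g x := fun x => by rw [hg]; positivity
  calc ∑ i ∈ s, ‖(((β / N : ℝ)) : ℂ) * framePosKernel L K (i.2.1.2 - i.2.2)‖ = ∑ i ∈ s, g i.2.1.2 := sum_congr rfl hcongr
    _ = ∑ x ∈ s.image (fun i : Fin 2 × (GridPoint L N × TorusSite 2 L) => i.2.1.2), g x := (sum_image hinj).symm
    _ ≤ ∑ x : TorusSite 2 L, g x := sum_le_sum_of_subset_of_nonneg (subset_univ _) fun x _ _ => hg0 x
    _ = |β| / N * ∑ z : TorusSite 2 L, ‖framePosKernel L K z‖ := by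
        rw [hg, ← mul_sum]
        congr 1
        exact Fintype.sum_equiv (Equiv.subRight w.1.1.2) _ _ fun x => by simp [Equiv.subRight]
    _ ≤ |β| / N * K.coeffNorm 0 := mul_le_mul_of_nonneg_left (sum_norm_framePosKernel_le K) (by positivity)

/-- **The pinned `ℓ¹` norm of the grid counterterm's `2`-point kernel**: for every leg `w` and both slots `p`,
`Σ_{Y : Y p = w} ‖kernel 𝒩_{K,N} 2 Y‖ ≤ (|β|/N)·coeffNorm 0 K` — the `N(1)` input of the determinant-bounded single-scale step, uniform in
`L`, `N` and the frame up to its coefficient weight. [cite: BenfattoGiulianiMastropietro2003, §1.2 The model (2.10)] -/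
theorem sum_norm_kernel_hubbardGridCounterQuadratic_le (β : ℝ) (K : TrigPolyC4v) (p : Fin 2) (w : GridLeg (GridPoint L N)) :
    ∑ Y ∈ univ.filter (fun Y : Fin 2 → GridLeg (GridPoint L N) => Y p = w),
      ‖kernel ℂ (hubbardGridCounterQuadratic L N β K) 2 Y‖ ≤ |β| / N * K.coeffNorm 0 := by
  rw [hubbardGridCounterQuadratic_eq_sum]
  exact sum_norm_kernel_two_structured_le univ _ _ _ (sum_filter_plusLeg_norm_coeff_le β K)
    (sum_filter_minusLeg_norm_coeff_le β K) p w

/-- The grid counterterm has kernels only in degree `2`. [cite: BenfattoGiulianiMastropietro2003, §1.2 The model (2.10)] -/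
theorem kernel_hubbardGridCounterQuadratic_of_ne (β : ℝ) (K : TrigPolyC4v) {m : ℕ} (hm : m ≠ 2)
    (Y : Fin m → GridLeg (GridPoint L N)) : kernel ℂ (hubbardGridCounterQuadratic L N β K) m Y = 0 := by
  rw [hubbardGridCounterQuadratic_eq_sum]
  exact kernel_two_structured_of_ne univ _ _ _ hm Y

end CounterKernels



end Literature.MathematicalPhysics.QuantumLattice

end
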